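import Summits.QuantumFields.BalabanUV.T4Continuum.Support.NE3CovariantTentInterpolantEnergy
import Summits.QuantumFields.BalabanUV.T4Continuum.Support.NE3CovariantTentInterpolantMean
import Summits.QuantumFields.BalabanUV.T4Continuum.Support.NE3CovariantTentInterpolantMeanDefect
import Summits.QuantumFields.BalabanUV.T4Continuum.Support.NE3CornerSpikes
import HarnessLib

/-!
# T⁴ programme, node NE3 — row E-MLw-(w4)-P-curved, route H♮, row K5c (file 5): THE S7 COMPETITOR — covariant tent interpolant of
# the block means + corner SPIKES + dressed bump: exact corners, exact transported block means, and its covariant energy in ONE theorem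

NE3 (node U1b) formalisation swarm, leaf seat `b2b-balaban-t4-ne3-formalise-leaf-01` (gen 6); row **K5** of ruling ρ-g22-2
(`HOME/t4/b2b-balaban-t4-ne3-p1/g22/D-ne3p1-g22-1.md` §2 S7 «ζ̃′ := I_W(m) + Σ_z h_z·δ_{M•z} …; ζ̃′ − ζ′ ∈ Ξ₀₀(W)», remark A2 «the spikes
MUST go through `h_z` … a direct point evaluation is not curl-controlled»), sub-row **K5c** (FINDING F-ne3leaf01g6-1 ∕ INTENT,
`HOME/CLAIMS.log` 2026-08-20 ≈18:08Z ∕ ≈18:15Z).  Assembles files 1–4 BY NAME.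

THE OBJECT.  Coarse data on the unit lattice of corners: block means `b` (to be interpolated) and corner values `c` (to be met by
spikes — interpolating corner data would put `Σ‖D_U c‖²` and `M^{d−2}·Σ‖c − b‖²` into the energy; spikes cost `4d·Σ‖c − b‖²`).
`spikeW M h y := h (cdiv M y)` at corners (`cmod M y = 0`), `0` elsewhere; the mean-correction coefficient
`compCoef M W b c z := (tentSum d M)⁻¹ • (M^d • (b z − bmeanW M W (tinterpW M W b) z) − (c z − b z))`; and
**`competitorW M W b c := tinterpW M W b + spikeW M (c − b) + dressW M W (bump M (compCoef M W b c))`**.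
CONTENT ([folklore]; 0 sorry; DATA defs `compCoef`, `competitorW`; the spike kit is `NE3CornerSpikes`):
§2 **`competitorW_corner`** (`= c z`), **`bmeanW_competitorW`** (`= b z` EXACT, `M ≥ 2`), `competitorW_mem_skewAdjoint`, `competitorW_add_period`;
§3 `norm_compCoef_le` and **THE END `sum_normSq_gaugeDir_competitorW_le`** (`M ≥ 2`, `N ≥ 1`, `d ≥ 1`; `W`, `U` unitary, `SmallField W a`,
   `SmallField U a_U`, `‖U − bseg M W‖ ≤ δ` bondwise, `b`, `c`, `U` `N`-periodic): with `D = Σ_{z∈periodBox N}Σ_α ‖gaugeDir U b z α‖²`,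
   `S_b = Σ_z ‖b z‖²`, `S_h = Σ_z ‖c z − b z‖²`, `κ = 1∕M + 2(d−1)(M−1)a`, `K₁ = 8(dMa)² + (16∕M²)(δ + 9d²M²a)²`,
   `K₂ = 2^{2d+4}d²(d−1)²a_U² + 8(9d²M²a + dδ)²`:
   `Σ_{y∈periodBox(M·N)} Σ_α ‖gaugeDir W (competitorW M W b c) y α‖²
      ≤ 3·(2^{d+1}(M^d∕M²)·D + d·2^d·M^d·K₁·S_b) + 12d·S_h + 3d·M^d·κ²·(2·64^d·(2^{3d+2}·d·D + 2^d·K₂·S_b) + 2·64^d·(M^d)⁻²·S_h)`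
   — every `D`- and `S_b`-coefficient is `M^{d−2}·C(d)·(1 + polynomial in M²a, δ, a_U, (d−1)(M−1)M·a)` (the S7 shape, `M²a ≤ b∕L²`), and the
   spike term is `O(d)·S_h` with NO `M^{d−2}` (A2).

HONEST FRAMING.  Kinematics of OUR competitor at one background in the small-field class; nothing about Bałaban's minimisers;
(P♮)_W ∕ (ML_w) at W ≠ 1, T-E_w and **NE3 are NOT proved**; spine PROVED 0∕9; finite T⁴ rung (B)+1 — NOT infinite volume, NOT
mass gap, NOT `BetaPertH`, NOT Clay.  PLACEMENT: `Summits/QuantumFields/BalabanUV/`.  HONEST DEPENDENCY (cell page 1): continuum YM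
on T⁴ ⇐ BetaPertH ∧ nine spine estimates (0/9 proved); BetaPertH ⇐ (D1) ∧ (D4) ∧ CAP+tail; G-an2-4 gates asym, D1 and NE2/3/4.
-/

set_option autoImplicit false

open scoped BigOperators Matrix.Norms.L2Operator
open Finset

namespace Summit.QuantumFields.BalabanUV.T4Continuum.NE3CovariantCompetitor

open Literature.MathematicalPhysics.QuantumFieldTheory.Balaban1983to89
open B7Prop1Explicit B7Prop2Explicit
open T4AveragingDeficitWall (IsUnitaryCfg SmallField Ad)
open T4AveragingDeficitWallBoundary (periodBox mem_periodBox card_periodBox IsPeriodicCfg sum_periodBox_shift)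
open AveragingDeficitTransport (Ad_mem_skewAdjoint norm_Ad_of_unitary)
open AveragingDeficitNearIdentity (Ad_one Ad_add Ad_zero)
open AveragingDeficitBlockDensity (btree bseg btree_mem)
open BlockAveragePushDirGauge (gaugeDir)
open SkeletonLattice (cdiv cmod smul_cdiv_add_cmod cdiv_add_period cmod_add_period)
open SmoothRefineInterp (indic)
open NE3BlockLineAverage (sum_periodBox_blocks sum_univ_boxVec)
open NE3TentBump (tentSum tentSum_pos le_tentSum bump bump_corner sum_block_bump bump_add_period)
open NE3CovariantBlockMean (bmeanW bmeanW_mem_skewAdjoint bmeanW_add_period cdiv_cmod_block)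
open NE3DressedBlockField (dressW dressW_corner dressW_mem_skewAdjoint dressW_add_period bmeanW_dressW cdiv_corner)
open NE3CovariantTentInterpolant (tinterpW tinterpW_corner tinterpW_mem_skewAdjoint tinterpW_add_period)
open NE3CovariantTentInterpolantEnergy (sum_normSq_gaugeDir_tinterpW_le)
open NE3CovariantTentInterpolantMean (bmeanW_add' sum_normSq_gaugeDir_dressW_bump_le)
open NE3CovariantTentInterpolantMeanDefect (normSq_sub_bmeanW_tinterpW_le)
open NE3CornerSpikes (spikeW spikeW_corner spikeW_mem_skewAdjoint spikeW_add_period bmeanW_spikeW sum_normSq_gaugeDir_spikeW_le)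

noncomputable section

variable {d : ℕ} {n : Type*} [Fintype n] [DecidableEq n]

/-! ## §2 The competitor: exact corners and exact transported block means -/

/-- THE MEAN-CORRECTION COEFFICIENT of the competitor (compensating the interpolation defect AND the spike's mean). [folklore] -/
def compCoef (M : ℕ) (W : Site d → Fin d → (Matrix n n ℂ)ˣ) (b c : Site d → Matrix n n ℂ) (z : Site d) : Matrix n n ℂ :=
  (tentSum d M)⁻¹ • (((M : ℝ) ^ d) • (b z - bmeanW M W (tinterpW M W b) z) - (c z - b z))

/-- **THE S7 COMPETITOR**: the covariant tent interpolant of the block means, corner spikes of height `c − b`, and the dressed bump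
restoring the transported block means. [folklore] -/
def competitorW (M : ℕ) (W : Site d → Fin d → (Matrix n n ℂ)ˣ) (b c : Site d → Matrix n n ℂ) (y : Site d) : Matrix n n ℂ :=
  tinterpW M W b y + spikeW M (fun z => c z - b z) y + dressW M W (bump M (compCoef M W b c)) y

/-- **CORNER VALUES**: `competitorW M W b c (M•z) = c z` (`M ≥ 1`, `d ≥ 1`). [folklore] -/
theorem competitorW_corner {M : ℕ} (hM : 1 ≤ M) (hd : 0 < d) (W : Site d → Fin d → (Matrix n n ℂ)ˣ) (b c : Site d → Matrix n n ℂ)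
    (z : Site d) : competitorW M W b c ((M : ℤ) • z) = c z := by
  unfold competitorW
  rw [tinterpW_corner hM, spikeW_corner hM, dressW_corner hM, bump_corner hM hd, add_zero, add_sub_cancel]

/-- **EXACT TRANSPORTED BLOCK MEANS**: `bmeanW M W (competitorW M W b c) z = b z` (`M ≥ 2`). [folklore] -/
theorem bmeanW_competitorW {M : ℕ} (hM : 2 ≤ M) (W : Site d → Fin d → (Matrix n n ℂ)ˣ) (b c : Site d → Matrix n n ℂ) (z : Site d) :
    bmeanW M W (competitorW M W b c) z = b z := by
  have hM1 : 1 ≤ M := by omega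
  have hM0 : ((M : ℝ) ^ d) ≠ 0 := by
    have : (0 : ℝ) < M := by exact_mod_cast (by omega : 0 < M)
    positivity
  have hT : tentSum d M ≠ 0 := (tentSum_pos hM d).ne'
  have h1 : bmeanW M W (competitorW M W b c) z
      = bmeanW M W (tinterpW M W b) z + bmeanW M W (spikeW M (fun z => c z - b z)) z
        + bmeanW M W (dressW M W (bump M (compCoef M W b c))) z := by
    unfold competitorW
    rw [bmeanW_add' M W (fun y => tinterpW M W b y + spikeW M (fun z => c z - b z) y), bmeanW_add']
  rw [h1, bmeanW_spikeW hM1, bmeanW_dressW, sum_block_bump hM1, compCoef]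
  simp only [smul_sub, smul_smul]
  have hc1 : ((M : ℝ) ^ d)⁻¹ * (tentSum d M * ((tentSum d M)⁻¹ * (M : ℝ) ^ d)) = 1 := by field_simp
  have hc2 : ((M : ℝ) ^ d)⁻¹ * (tentSum d M * (tentSum d M)⁻¹) = ((M : ℝ) ^ d)⁻¹ := by field_simp
  simp only [hc1, hc2, one_smul]
  abel

/-- The competitor's coefficient is 𝔲(n)-valued for 𝔲(n)-valued data at a unitary background. [folklore] -/
theorem compCoef_mem_skewAdjoint (M : ℕ) {W : Site d → Fin d → (Matrix n n ℂ)ˣ} (hW : IsUnitaryCfg W) {b c : Site d → Matrix n n ℂ}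
    (hb : ∀ w, b w ∈ skewAdjoint (Matrix n n ℂ)) (hc : ∀ w, c w ∈ skewAdjoint (Matrix n n ℂ)) (z : Site d) :
    compCoef M W b c z ∈ skewAdjoint (Matrix n n ℂ) := by
  unfold compCoef
  refine skewAdjoint.smul_mem _ ((skewAdjoint (Matrix n n ℂ)).sub_mem (skewAdjoint.smul_mem _
    ((skewAdjoint (Matrix n n ℂ)).sub_mem (hb z) ?_)) ((skewAdjoint (Matrix n n ℂ)).sub_mem (hc z) (hb z)))
  exact bmeanW_mem_skewAdjoint M hW (fun x => tinterpW_mem_skewAdjoint M hW hb x) z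

/-- **THE COMPETITOR IS 𝔲(n)-VALUED** for 𝔲(n)-valued data at a unitary background. [folklore] -/
theorem competitorW_mem_skewAdjoint (M : ℕ) {W : Site d → Fin d → (Matrix n n ℂ)ˣ} (hW : IsUnitaryCfg W) {b c : Site d → Matrix n n ℂ}
    (hb : ∀ w, b w ∈ skewAdjoint (Matrix n n ℂ)) (hc : ∀ w, c w ∈ skewAdjoint (Matrix n n ℂ)) (y : Site d) :
    competitorW M W b c y ∈ skewAdjoint (Matrix n n ℂ) := by
  unfold competitorW
  refine (skewAdjoint (Matrix n n ℂ)).add_mem ((skewAdjoint (Matrix n n ℂ)).add_mem (tinterpW_mem_skewAdjoint M hW hb y)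
    (spikeW_mem_skewAdjoint M (fun z => (skewAdjoint (Matrix n n ℂ)).sub_mem (hc z) (hb z)) y)) (dressW_mem_skewAdjoint M hW ?_ y)
  intro x
  unfold bump
  exact skewAdjoint.smul_mem _ (compCoef_mem_skewAdjoint M hW hb hc _)

/-- Periodicity of the coefficient (`M ≥ 1`, `W` `(M·N)`-periodic, `b`, `c` `N`-periodic). [folklore] -/
theorem compCoef_add_period {M : ℕ} (hM : 1 ≤ M) {N : ℕ} {W : Site d → Fin d → (Matrix n n ℂ)ˣ}
    (hWP : IsPeriodicCfg W ((M : ℤ) * N)) {b c : Site d → Matrix n n ℂ}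
    (hb : ∀ (z : Site d) (τ : Fin d), b (z + (N : ℤ) • e τ) = b z) (hc : ∀ (z : Site d) (τ : Fin d), c (z + (N : ℤ) • e τ) = c z)
    (z : Site d) (τ : Fin d) : compCoef M W b c (z + (N : ℤ) • e τ) = compCoef M W b c z := by
  unfold compCoef
  have hP : ∀ (x : Site d) (i : Fin d), tinterpW M W b (x + ((M : ℤ) * (N : ℤ)) • e i) = tinterpW M W b x := by
    intro x i
    have h := tinterpW_add_period hM hWP hb x i
    have hcast : ((M * N : ℕ) : ℤ) = (M : ℤ) * (N : ℤ) := by push_cast; ring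
    rwa [hcast] at h
  rw [hb, hc, bmeanW_add_period M (P := (N : ℤ)) hWP hP]

/-- **PERIODICITY** of the competitor (`M ≥ 1`, `W` `(M·N)`-periodic, `b`, `c` `N`-periodic). [folklore] -/
theorem competitorW_add_period {M : ℕ} (hM : 1 ≤ M) {N : ℕ} {W : Site d → Fin d → (Matrix n n ℂ)ˣ}
    (hWP : IsPeriodicCfg W ((M : ℤ) * N)) {b c : Site d → Matrix n n ℂ}
    (hb : ∀ (z : Site d) (τ : Fin d), b (z + (N : ℤ) • e τ) = b z) (hc : ∀ (z : Site d) (τ : Fin d), c (z + (N : ℤ) • e τ) = c z)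
    (y : Site d) (τ : Fin d) :
    competitorW M W b c (y + ((M * N : ℕ) : ℤ) • e τ) = competitorW M W b c y := by
  unfold competitorW
  have hcast : ((M * N : ℕ) : ℤ) = (M : ℤ) * (N : ℤ) := by push_cast; ring
  have hbump : ∀ (x : Site d) (i : Fin d),
      bump M (compCoef M W b c) (x + ((M : ℤ) * N) • e i) = bump M (compCoef M W b c) x := by
    intro x i
    have h := bump_add_period hM (compCoef_add_period hM hWP hb hc) x i
    rwa [hcast] at h
  rw [tinterpW_add_period hM hWP hb, spikeW_add_period hM (fun z τ => by simp only [hb, hc]), hcast, dressW_add_period hM hWP hbump]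

/-! ## §3 The energy of the competitor -/

/-- The size of the competitor's coefficient (`M ≥ 2`):
`‖compCoef M W b c z‖ ≤ 8^d·(‖b z − bmeanW M W (tinterpW M W b) z‖ + (M^d)⁻¹·‖c z − b z‖)`. [folklore] -/
theorem norm_compCoef_le {M : ℕ} (hM : 2 ≤ M) (W : Site d → Fin d → (Matrix n n ℂ)ˣ) (b c : Site d → Matrix n n ℂ) (z : Site d) :
    ‖compCoef M W b c z‖
      ≤ (8 : ℝ) ^ d * (‖b z - bmeanW M W (tinterpW M W b) z‖ + ((M : ℝ) ^ d)⁻¹ * ‖c z - b z‖) := by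
  have hM0 : (0 : ℝ) < (M : ℝ) ^ d := by
    have : (0 : ℝ) < M := by exact_mod_cast (by omega : 0 < M)
    positivity
  have hTS := tentSum_pos hM d
  have hTSle := le_tentSum hM d
  have hq : (tentSum d M)⁻¹ ≤ (8 : ℝ) ^ d * ((M : ℝ) ^ d)⁻¹ := by
    rw [inv_le_iff_one_le_mul₀ hTS]
    calc (1 : ℝ) = (8 : ℝ) ^ d * ((M : ℝ) ^ d)⁻¹ * ((M : ℝ) / 8) ^ d := by
          rw [div_pow, mul_assoc, ← mul_div_assoc, inv_mul_cancel₀ hM0.ne']; field_simp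
      _ ≤ (8 : ℝ) ^ d * ((M : ℝ) ^ d)⁻¹ * tentSum d M := mul_le_mul_of_nonneg_left hTSle (by positivity)
  unfold compCoef
  rw [norm_smul, Real.norm_of_nonneg (inv_nonneg.mpr hTS.le)]
  have htri : ‖((M : ℝ) ^ d) • (b z - bmeanW M W (tinterpW M W b) z) - (c z - b z)‖
      ≤ (M : ℝ) ^ d * ‖b z - bmeanW M W (tinterpW M W b) z‖ + ‖c z - b z‖ := by
    refine (norm_sub_le _ _).trans ?_
    rw [norm_smul, Real.norm_of_nonneg hM0.le]
  calc (tentSum d M)⁻¹ * ‖((M : ℝ) ^ d) • (b z - bmeanW M W (tinterpW M W b) z) - (c z - b z)‖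
      ≤ ((8 : ℝ) ^ d * ((M : ℝ) ^ d)⁻¹) * ((M : ℝ) ^ d * ‖b z - bmeanW M W (tinterpW M W b) z‖ + ‖c z - b z‖) :=
        mul_le_mul hq htri (norm_nonneg _) (by positivity)
    _ = (8 : ℝ) ^ d * (‖b z - bmeanW M W (tinterpW M W b) z‖ + ((M : ℝ) ^ d)⁻¹ * ‖c z - b z‖) := by
        field_simp

/-- `gaugeDir` is additive in the field. [folklore] -/
theorem gaugeDir_add' (W : Site d → Fin d → (Matrix n n ℂ)ˣ) (F G : Site d → Matrix n n ℂ) (y : Site d) (α : Fin d) :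
    gaugeDir W (fun x => F x + G x) y α = gaugeDir W F y α + gaugeDir W G y α := by
  simp only [gaugeDir, Ad_add]; abel

section End

variable [Nonempty n]

/-- **THE COVARIANT ENERGY OF THE S7 COMPETITOR — ONE THEOREM** (`M ≥ 2`, `N ≥ 1`, `d ≥ 1`; `W`, `U` unitary; `SmallField W a`,
`SmallField U a_U`, `0 ≤ a, a_U, δ`; `‖U − bseg M W‖ ≤ δ` bondwise; `U`, `b`, `c` `N`-periodic): with the abbreviations of the module
docstring,
`Σ_{y∈periodBox(M·N)} Σ_α ‖gaugeDir W (competitorW M W b c) y α‖²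
   ≤ 3·(2^{d+1}(M^d∕M²)·D + d·2^d·M^d·K₁·S_b) + 12d·S_h + 3·(d·M^d·κ²)·(2·64^d·(2^{3d+2}·d·D + 2^d·K₂·S_b) + 2·64^d·(M^d)⁻²·S_h)`. [folklore] -/
theorem sum_normSq_gaugeDir_competitorW_le {M N : ℕ} (hM : 2 ≤ M) (hN : 1 ≤ N) (hd : 0 < d)
    {W U : Site d → Fin d → (Matrix n n ℂ)ˣ} (hW : IsUnitaryCfg W) (hU : IsUnitaryCfg U) {a aU δ : ℝ} (ha : 0 ≤ a) (haU : 0 ≤ aU)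
    (hWa : SmallField W a) (hUa : SmallField U aU)
    (hδ : ∀ (w : Site d) (α : Fin d), ‖((U w α : (Matrix n n ℂ)ˣ) : Matrix n n ℂ) - bseg M W w α‖ ≤ δ)
    (hUP : IsPeriodicCfg U (N : ℤ)) {b c : Site d → Matrix n n ℂ}
    (hb : ∀ (z : Site d) (τ : Fin d), b (z + (N : ℤ) • e τ) = b z) (hc : ∀ (z : Site d) (τ : Fin d), c (z + (N : ℤ) • e τ) = c z) :
    ∑ y ∈ periodBox (d := d) (M * N), ∑ α : Fin d, ‖gaugeDir W (competitorW M W b c) y α‖ ^ 2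
      ≤ 3 * ((2 : ℝ) ^ (d + 1) * ((M : ℝ) ^ d / (M : ℝ) ^ 2) * ∑ z ∈ periodBox (d := d) N, ∑ α : Fin d, ‖gaugeDir U b z α‖ ^ 2
            + (d : ℝ) * (2 : ℝ) ^ d * (M : ℝ) ^ d
              * (8 * ((d : ℝ) * M * a) ^ 2 + (16 / (M : ℝ) ^ 2) * (δ + 9 * (d : ℝ) ^ 2 * (M : ℝ) ^ 2 * a) ^ 2)
              * ∑ z ∈ periodBox (d := d) N, ‖b z‖ ^ 2)
        + 12 * (d : ℝ) * ∑ z ∈ periodBox (d := d) N, ‖c z - b z‖ ^ 2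
        + 3 * ((d : ℝ) * (M : ℝ) ^ d * (1 / (M : ℝ) + 2 * (((d : ℝ) - 1) * ((M : ℝ) - 1) * a)) ^ 2)
          * (2 * (64 : ℝ) ^ d
              * ((2 : ℝ) ^ (3 * d + 2) * d * ∑ z ∈ periodBox (d := d) N, ∑ α : Fin d, ‖gaugeDir U b z α‖ ^ 2
                + (2 : ℝ) ^ d * ((2 : ℝ) ^ (2 * d + 4) * (d : ℝ) ^ 2 * ((d : ℝ) - 1) ^ 2 * aU ^ 2
                    + 8 * (9 * (d : ℝ) ^ 2 * (M : ℝ) ^ 2 * a + (d : ℝ) * δ) ^ 2) * ∑ z ∈ periodBox (d := d) N, ‖b z‖ ^ 2)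
            + 2 * (64 : ℝ) ^ d * (((M : ℝ) ^ d)⁻¹) ^ 2 * ∑ z ∈ periodBox (d := d) N, ‖c z - b z‖ ^ 2) := by
  have hM1 : 1 ≤ M := by omega
  have hM0 : (0 : ℝ) < M := by exact_mod_cast (by omega : 0 < M)
  have hδ0 : 0 ≤ δ := (norm_nonneg _).trans (hδ 0 ⟨0, hd⟩)
  -- (1) the three pieces
  have hE1 := sum_normSq_gaugeDir_tinterpW_le hM1 hN hW hU ha hWa hδ hUP hb
  have hE2 := sum_normSq_gaugeDir_spikeW_le (M := M) hM1 hN hW (h := fun z => c z - b z) (fun z τ => by simp only [hb, hc])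
  have hE3 := sum_normSq_gaugeDir_dressW_bump_le hM1 N hW ha hWa (compCoef M W b c)
  -- (2) the coefficient against the data
  have hcoefpt : ∀ z : Site d, ‖compCoef M W b c z‖ ^ 2
      ≤ 2 * (64 : ℝ) ^ d * ‖b z - bmeanW M W (tinterpW M W b) z‖ ^ 2 + 2 * (64 : ℝ) ^ d * ((((M : ℝ) ^ d)⁻¹) * ‖c z - b z‖) ^ 2 := by
    intro z
    have h := norm_compCoef_le hM W b c z
    have h64 : ((8 : ℝ) ^ d) ^ 2 = (64 : ℝ) ^ d := by rw [← pow_mul, mul_comm, pow_mul]; norm_num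
    have h0 : 0 ≤ ‖b z - bmeanW M W (tinterpW M W b) z‖ + ((M : ℝ) ^ d)⁻¹ * ‖c z - b z‖ := by positivity
    calc ‖compCoef M W b c z‖ ^ 2
        ≤ ((8 : ℝ) ^ d * (‖b z - bmeanW M W (tinterpW M W b) z‖ + ((M : ℝ) ^ d)⁻¹ * ‖c z - b z‖)) ^ 2 :=
          pow_le_pow_left₀ (norm_nonneg _) h 2
      _ = (64 : ℝ) ^ d * (‖b z - bmeanW M W (tinterpW M W b) z‖ + ((M : ℝ) ^ d)⁻¹ * ‖c z - b z‖) ^ 2 := by rw [mul_pow, h64]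
      _ ≤ (64 : ℝ) ^ d * (2 * ‖b z - bmeanW M W (tinterpW M W b) z‖ ^ 2 + 2 * (((M : ℝ) ^ d)⁻¹ * ‖c z - b z‖) ^ 2) := by
          refine mul_le_mul_of_nonneg_left ?_ (by positivity)
          nlinarith only [sq_nonneg (‖b z - bmeanW M W (tinterpW M W b) z‖ - ((M : ℝ) ^ d)⁻¹ * ‖c z - b z‖)]
      _ = _ := by ring
  have hdef : ∀ z : Site d, ‖b z - bmeanW M W (tinterpW M W b) z‖ ^ 2
      ≤ (2 : ℝ) ^ (2 * d + 2) * d * ∑ S ∈ (Finset.univ : Finset (Fin d)).powerset, ∑ i : Fin d, ‖gaugeDir U b (z + indic S) i‖ ^ 2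
        + ((2 : ℝ) ^ (2 * d + 4) * (d : ℝ) ^ 2 * ((d : ℝ) - 1) ^ 2 * aU ^ 2
            + 8 * (9 * (d : ℝ) ^ 2 * (M : ℝ) ^ 2 * a + (d : ℝ) * δ) ^ 2)
          * ∑ T ∈ (Finset.univ : Finset (Fin d)).powerset, ‖b (z + indic T)‖ ^ 2 :=
    fun z => normSq_sub_bmeanW_tinterpW_le hM1 hW hU ha haU hδ0 hWa hUa hδ b z
  -- periodic shifts of the cube sums
  have hshiftD : ∀ S : Finset (Fin d), ∑ z ∈ periodBox (d := d) N, ∑ i : Fin d, ‖gaugeDir U b (z + indic S) i‖ ^ 2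
      = ∑ z ∈ periodBox (d := d) N, ∑ α : Fin d, ‖gaugeDir U b z α‖ ^ 2 := by
    intro S
    refine sum_periodBox_shift N hN (g := fun z => ∑ i : Fin d, ‖gaugeDir U b z i‖ ^ 2) (fun x κ => ?_) (indic S)
    refine Finset.sum_congr rfl fun i _ => ?_
    simp only [gaugeDir]
    rw [hUP x κ i, add_right_comm, hb, hb]
  have hshiftB : ∀ T : Finset (Fin d), ∑ z ∈ periodBox (d := d) N, ‖b (z + indic T)‖ ^ 2 = ∑ z ∈ periodBox (d := d) N, ‖b z‖ ^ 2 :=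
    fun T => sum_periodBox_shift N hN (g := fun z => ‖b z‖ ^ 2) (fun x κ => by simp only [hb]) (indic T)
  have hpow : (((Finset.univ : Finset (Fin d)).powerset.card : ℝ)) = (2 : ℝ) ^ d := by
    rw [Finset.card_powerset, Finset.card_univ, Fintype.card_fin]; push_cast; ring
  have hdefsum : ∑ z ∈ periodBox (d := d) N, ‖b z - bmeanW M W (tinterpW M W b) z‖ ^ 2
      ≤ (2 : ℝ) ^ (3 * d + 2) * d * ∑ z ∈ periodBox (d := d) N, ∑ α : Fin d, ‖gaugeDir U b z α‖ ^ 2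
        + (2 : ℝ) ^ d * ((2 : ℝ) ^ (2 * d + 4) * (d : ℝ) ^ 2 * ((d : ℝ) - 1) ^ 2 * aU ^ 2
            + 8 * (9 * (d : ℝ) ^ 2 * (M : ℝ) ^ 2 * a + (d : ℝ) * δ) ^ 2) * ∑ z ∈ periodBox (d := d) N, ‖b z‖ ^ 2 := by
    refine (Finset.sum_le_sum fun z _ => hdef z).trans (le_of_eq ?_)
    have hA : ∑ z ∈ periodBox (d := d) N, ∑ S ∈ (Finset.univ : Finset (Fin d)).powerset, ∑ i : Fin d, ‖gaugeDir U b (z + indic S) i‖ ^ 2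
        = (2 : ℝ) ^ d * ∑ z ∈ periodBox (d := d) N, ∑ α : Fin d, ‖gaugeDir U b z α‖ ^ 2 := by
      rw [Finset.sum_comm, Finset.sum_congr rfl fun S _ => hshiftD S, Finset.sum_const, nsmul_eq_mul, hpow]
    have hB : ∑ z ∈ periodBox (d := d) N, ∑ T ∈ (Finset.univ : Finset (Fin d)).powerset, ‖b (z + indic T)‖ ^ 2
        = (2 : ℝ) ^ d * ∑ z ∈ periodBox (d := d) N, ‖b z‖ ^ 2 := by
      rw [Finset.sum_comm, Finset.sum_congr rfl fun T _ => hshiftB T, Finset.sum_const, nsmul_eq_mul, hpow]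
    rw [Finset.sum_add_distrib, ← Finset.mul_sum, ← Finset.mul_sum, hA, hB, show 3 * d + 2 = d + (2 * d + 2) by ring, pow_add]
    ring
  have hcoef : ∑ z ∈ periodBox (d := d) N, ‖compCoef M W b c z‖ ^ 2
      ≤ 2 * (64 : ℝ) ^ d
          * ((2 : ℝ) ^ (3 * d + 2) * d * ∑ z ∈ periodBox (d := d) N, ∑ α : Fin d, ‖gaugeDir U b z α‖ ^ 2
            + (2 : ℝ) ^ d * ((2 : ℝ) ^ (2 * d + 4) * (d : ℝ) ^ 2 * ((d : ℝ) - 1) ^ 2 * aU ^ 2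
                + 8 * (9 * (d : ℝ) ^ 2 * (M : ℝ) ^ 2 * a + (d : ℝ) * δ) ^ 2) * ∑ z ∈ periodBox (d := d) N, ‖b z‖ ^ 2)
        + 2 * (64 : ℝ) ^ d * (((M : ℝ) ^ d)⁻¹) ^ 2 * ∑ z ∈ periodBox (d := d) N, ‖c z - b z‖ ^ 2 := by
    have h1 : ∑ z ∈ periodBox (d := d) N, ‖compCoef M W b c z‖ ^ 2
        ≤ ∑ z ∈ periodBox (d := d) N, (2 * (64 : ℝ) ^ d * ‖b z - bmeanW M W (tinterpW M W b) z‖ ^ 2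
            + 2 * (64 : ℝ) ^ d * ((((M : ℝ) ^ d)⁻¹) * ‖c z - b z‖) ^ 2) := Finset.sum_le_sum fun z _ => hcoefpt z
    have h2 : ∑ z ∈ periodBox (d := d) N, (2 * (64 : ℝ) ^ d * ‖b z - bmeanW M W (tinterpW M W b) z‖ ^ 2
            + 2 * (64 : ℝ) ^ d * ((((M : ℝ) ^ d)⁻¹) * ‖c z - b z‖) ^ 2)
        = 2 * (64 : ℝ) ^ d * ∑ z ∈ periodBox (d := d) N, ‖b z - bmeanW M W (tinterpW M W b) z‖ ^ 2
          + 2 * (64 : ℝ) ^ d * (((M : ℝ) ^ d)⁻¹) ^ 2 * ∑ z ∈ periodBox (d := d) N, ‖c z - b z‖ ^ 2 := by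
      rw [Finset.sum_add_distrib, ← Finset.mul_sum, Finset.mul_sum, Finset.mul_sum]
      congr 1
      exact Finset.sum_congr rfl fun z _ => by ring
    have h64 : (0 : ℝ) ≤ 2 * (64 : ℝ) ^ d := by positivity
    have h3 := mul_le_mul_of_nonneg_left hdefsum h64
    linarith only [h1, h2.le, h2.ge, h3]
  -- (3) split the covariant gradient of the sum into the three pieces
  have hsplit : ∀ (y : Site d) (α : Fin d), ‖gaugeDir W (competitorW M W b c) y α‖ ^ 2
      ≤ 3 * ‖gaugeDir W (tinterpW M W b) y α‖ ^ 2 + 3 * ‖gaugeDir W (spikeW M fun z => c z - b z) y α‖ ^ 2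
        + 3 * ‖gaugeDir W (dressW M W (bump M (compCoef M W b c))) y α‖ ^ 2 := by
    intro y α
    have h3 : gaugeDir W (competitorW M W b c) y α = gaugeDir W (tinterpW M W b) y α
        + gaugeDir W (spikeW M fun z => c z - b z) y α + gaugeDir W (dressW M W (bump M (compCoef M W b c))) y α := by
      have e1 : competitorW M W b c
          = fun x => (fun x' => tinterpW M W b x' + spikeW M (fun z => c z - b z) x') x
              + dressW M W (bump M (compCoef M W b c)) x := rfl
      rw [e1, gaugeDir_add', gaugeDir_add']
    rw [h3]
    have h := norm_add₃_le (a := gaugeDir W (tinterpW M W b) y α) (b := gaugeDir W (spikeW M fun z => c z - b z) y α)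
      (c := gaugeDir W (dressW M W (bump M (compCoef M W b c))) y α)
    calc _ ≤ (‖gaugeDir W (tinterpW M W b) y α‖ + ‖gaugeDir W (spikeW M fun z => c z - b z) y α‖
          + ‖gaugeDir W (dressW M W (bump M (compCoef M W b c))) y α‖) ^ 2 := pow_le_pow_left₀ (norm_nonneg _) h 2
      _ ≤ _ := by
          nlinarith only [sq_nonneg (‖gaugeDir W (tinterpW M W b) y α‖ - ‖gaugeDir W (spikeW M fun z => c z - b z) y α‖),
            sq_nonneg (‖gaugeDir W (tinterpW M W b) y α‖ - ‖gaugeDir W (dressW M W (bump M (compCoef M W b c))) y α‖),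
            sq_nonneg (‖gaugeDir W (spikeW M fun z => c z - b z) y α‖
              - ‖gaugeDir W (dressW M W (bump M (compCoef M W b c))) y α‖)]
  have hsum : ∑ y ∈ periodBox (d := d) (M * N), ∑ α : Fin d, ‖gaugeDir W (competitorW M W b c) y α‖ ^ 2
      ≤ 3 * ∑ y ∈ periodBox (d := d) (M * N), ∑ α : Fin d, ‖gaugeDir W (tinterpW M W b) y α‖ ^ 2
        + 3 * ∑ y ∈ periodBox (d := d) (M * N), ∑ α : Fin d, ‖gaugeDir W (spikeW M fun z => c z - b z) y α‖ ^ 2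
        + 3 * ∑ y ∈ periodBox (d := d) (M * N), ∑ α : Fin d, ‖gaugeDir W (dressW M W (bump M (compCoef M W b c))) y α‖ ^ 2 := by
    refine (Finset.sum_le_sum fun y _ => Finset.sum_le_sum fun α _ => hsplit y α).trans (le_of_eq ?_)
    simp only [Finset.sum_add_distrib, Finset.mul_sum]
  -- (4) assemble
  have hκ0 : 0 ≤ (d : ℝ) * (M : ℝ) ^ d * (1 / (M : ℝ) + 2 * (((d : ℝ) - 1) * ((M : ℝ) - 1) * a)) ^ 2 := by positivity
  have hE3' := hE3.trans (mul_le_mul_of_nonneg_left hcoef hκ0)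
  linarith only [hsum, hE1, hE2, hE3']

end End

end

end Summit.QuantumFields.BalabanUV.T4Continuum.NE3CovariantCompetitor
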